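import Summits.QuantumFields.YangMills.Theorems.LuscherReductionUpperTraceDoorWeyl
import HarnessLib

/-!
# Crux RED `RunningReduction` (stmt-QuantumFields-19978), child `TwistedTraceScaling` (stmt-QuantumFields-20203): the UPPER-HALF TT DOOR —
# CERTIFICATE (W2): `CoarseLevels ∧ FemtoWeyl ⟹ UpperTraceLaw`, hence `TwistedTraceScaling ⟹ UpperTraceLaw` UNCONDITIONALLY (INV landed)

Support module of the `FemtoTransferGap` group (fleet service by seat ym-infvol-p2 g7; route `LuscherReduction`, owner ym-beyond-p1, femto rung R2b1).
RE-HOMES VERBATIM the second half of §4 and §5 of the planner's kernel-checked crux workfile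
`Summits/QuantumFields/YangMills/Cruxes/RunningReduction/Lines/upper_trace_door.lean` rev 3 (commit efcd23ff80e7, sha16 fb9acfdf08f96b2f; seat
ym-cruxidea-19978-1 GEN 7–8; memo `…/Lines/upper_trace_door.md` rev 4 §3 item 4 and §6 (i)) in namespace `…Theorems.FemtoTransferGap.UTD` (credit: the
planner's proofs, character for character, with `1 − e^{−u} ≤ u` supplied by `Real.add_one_le_exp`; `UTD.UpperTraceLawAt`, `UTD.FemtoWeylAt` are the tree
predicates of `…UpperTraceDoorDefs`; `CoarseLevels` is SPELLED OUT = the conclusion text of the tree's `TraceDoor.coarseLevels_of_twistedTraceScaling`).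

* §1 ★ (W2) `upperTraceLaw_of_coarseLevels : ⟨CoarseLevels⟩ → (∀ s0, 0 < s0 → UTD.FemtoWeylAt s0) → ∀ s ε …, UTD.UpperTraceLawAt s ε` (ONE closed,
  `TraceDoor.oneSiteLowerCoarse` by name; no `OneSiteTail` needed): given `(s, ε)`, Weyl at `s/2` gives `𝔷_L(T') ≤ C` at `T' = ⌈sL/2λ⌉`; a tail level `J`
  with `Δ_{J+1} ≥ 1 + (4/s)·log⁺(4C/ε)` (`levelGap → ∞`, `OSTail.tendsto_levelGap_atTop`) makes `Σ_{j>J} x_j^T ≤ x_{J+1}^{T−T'}𝔷_L(T') ≤ ε/4`, and on the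
  head `j ≤ J` the coarse upper `x_j ≤ e^{−(Δ_j−δ)x}` against the one-site lower `y_j ≥ e^{−(Δ_j+δ)x}` costs `≤ (J+1)·2δ(s+1) = ε/4`.
* §2 `upperTraceLaw_of_twistedTraceScaling : ⟨CoarseLevels⟩ → TwistedTraceScaling → UTL` ((W1)+(W2), child `OneSiteTail` closed) and
  ★ `upperTraceLaw_of_twistedTraceScaling' : TwistedTraceScaling → ∀ s ε …, UTD.UpperTraceLawAt s ε` with NO side hypothesis — the trace inversion INV is
  the landed `TraceDoor.coarseLevels_of_twistedTraceScaling` (`Theorems/LuscherReductionTraceDoorCorollary.lean`, seat ym-infvol-p1 g4): the one-sided law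
  is a COROLLARY of child 20203 as typed, by name, today.  (Converse: `…UpperTraceDoorConverse`.)

HONEST FRAMING: implications among OPEN statements on the femto rung R2b1 (`FemtoGapOfRecord`); `TwistedTraceScaling` ∕ UTL are XL and ASSUMED; nothing
here bears on infinite volume, the continuum limit in large volume, or the Clay mass gap.
References: M. Lüscher, NPB 219 (1983) 233 [cite: Luscher1983, §3]; W. Feller, vol. II, XIII.1 [cite: Feller1971, XIII.1 Thm 2a].
-/

set_option autoImplicit false

noncomputable section

open MeasureTheory Filter Topology Real
open Literature.MathematicalPhysics.QuantumFieldTheory hiding SU2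
open Literature.MathematicalPhysics.QuantumLattice
open Literature.Analysis.OperatorTheory.YMMatrixModel
open scoped BigOperators

namespace Summit.QuantumFields.YangMills.Theorems.FemtoTransferGap.UTD

open Summit.QuantumFields.YangMills.Theorems.FemtoTransferGap
open Summit.QuantumFields.YangMills.Theorems.FemtoTransferGap.TT (physTrace)
open Summit.QuantumFields.YangMills.Theorems.FemtoTransferGap.TraceDoor
open Summit.QuantumFields.YangMills.Theorems.FemtoTransferGap.KTRCalibration (levelValue_antitone)
open Summit.QuantumFields.YangMills.Theses.LuscherReduction (RunningReduction TwistedTraceScaling DressedRitz TraceFormula OneSiteTail)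

/-! ## §1 (W2) `CoarseLevels ∧ FemtoWeyl ⟹ UpperTraceLaw` (workfile §4, VERBATIM) -/

set_option maxHeartbeats 1600000 in
/-- ★ (W2) `CoarseLevels ∧ FemtoWeyl ⟹ UpperTraceLaw` (workfile §4, proof VERBATIM, credit ym-cruxidea-19978-1; ONE closed, `TraceDoor.oneSiteLowerCoarse` by name; no `OneSiteTail` needed): given `(s, ε)`, Weyl at `s/2`
gives `𝔷_L(T') ≤ C` at `T' = ⌈sL/2λ⌉`; a tail level `J` with `Δ_{J+1} ≥ 1 + (4/s)·log⁺(4C/ε)` (`levelGap → ∞`) makes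
`Σ_{j>J} x_j^T ≤ x_{J+1}^{T−T'}𝔷_L(T') ≤ ε/4` (coarse upper law at `J+1`, `(T−T')x ≥ s/4` deep in the window), and on the head `j ≤ J` the coarse upper
`x_j ≤ e^{−(Δ_j−δ)x}` against the one-site lower `y_j ≥ e^{−(Δ_j+δ)x}` costs `≤ (J+1)·2δ(s+1) = ε/4`. [cite: Luscher1983, §3] -/
theorem upperTraceLaw_of_coarseLevels
    (hCL : ∀ k : ℕ, ∀ η : ℝ, 0 < η → ∃ lam0 : ℝ, 0 < lam0 ∧ ∀ lam : ℝ, 0 < lam → lam ≤ lam0 →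
      ∃ L0 : ℕ, ∀ (L : ℕ) [NeZero L], L0 ≤ L → ∀ β : ℝ, InFemtoWindow lam β L →
        Real.exp (-((levelGap k + η) * luscherLambda β L) / L) * levelValue su2Rep L β 0 ≤ levelValue su2Rep L β k ∧
          levelValue su2Rep L β k ≤ Real.exp (-((levelGap k - η) * luscherLambda β L) / L) * levelValue su2Rep L β 0)
    (hWeyl : ∀ s0 : ℝ, 0 < s0 → UTD.FemtoWeylAt s0) :
    ∀ s : ℝ, 0 < s → ∀ ε : ℝ, 0 < ε → UTD.UpperTraceLawAt s ε := by
  intro s hs ε hε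
  unfold UTD.UpperTraceLawAt
  -- Weyl at `s/2`
  obtain ⟨CW, lamW, hlamW, hWs⟩ := hWeyl (s / 2) (by positivity)
  set C1 : ℝ := max CW 1 with hC1def
  have hC11 : 1 ≤ C1 := le_max_right _ _
  have hC1pos : 0 < C1 := one_pos.trans_le hC11
  have hCW1 : CW ≤ C1 := le_max_left _ _
  -- the tail level `J`
  set G : ℝ := max 0 (Real.log (4 * C1 / ε)) with hGdef
  have hG0 : 0 ≤ G := le_max_left _ _
  obtain ⟨J, hJ⟩ : ∃ J : ℕ, 1 + 4 / s * G ≤ levelGap (J + 1) := by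
    obtain ⟨N, hN⟩ := (tendsto_atTop_atTop.1 OSTail.tendsto_levelGap_atTop) (1 + 4 / s * G)
    exact ⟨N, hN (N + 1) (by omega)⟩
  have hrate : 0 ≤ levelGap (J + 1) - 1 := by
    have : 0 ≤ 4 / s * G := by positivity
    linarith only [hJ, this]
  -- head precision `δ`
  set δ : ℝ := ε / (8 * ((J : ℝ) + 1) * (s + 1)) with hδdef
  have hden : 0 < 8 * ((J : ℝ) + 1) * (s + 1) := by positivity
  have hδ : 0 < δ := div_pos hε hden
  obtain ⟨lamA, hlamA, hA⟩ := coarseUpper_uniform hCL hδ J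
  obtain ⟨lamB, hlamB, hB⟩ := coarseUpper_uniform hCL one_pos (J + 1)
  obtain ⟨B0, hB0⟩ := oneSiteLowerCoarse J δ hδ
  set Bs : ℝ := max B0 1 with hBsdef
  have hBs1 : 1 ≤ Bs := le_max_right _ _
  have hBspos : 0 < Bs := one_pos.trans_le hBs1
  have hq : 0 < min (s / 8) (min (1 / 8) (1 / (4 * Bs))) := lt_min (by positivity) (lt_min (by norm_num) (by positivity))
  refine ⟨min (min lamW (min lamA lamB)) (min (s / 8) (min (1 / 8) (1 / (4 * Bs)))),
    lt_min (lt_min hlamW (lt_min hlamA hlamB)) hq, fun lam hlam hlamle => ?_⟩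
  have hlamW' : lam ≤ lamW := hlamle.trans ((min_le_left _ _).trans (min_le_left _ _))
  have hlamA' : lam ≤ lamA := hlamle.trans ((min_le_left _ _).trans ((min_le_right _ _).trans (min_le_left _ _)))
  have hlamB' : lam ≤ lamB := hlamle.trans ((min_le_left _ _).trans ((min_le_right _ _).trans (min_le_right _ _)))
  have hlams : lam ≤ s / 8 := hlamle.trans ((min_le_right _ _).trans (min_le_left _ _))
  have hlam8 : lam ≤ 1 / 8 := hlamle.trans ((min_le_right _ _).trans ((min_le_right _ _).trans (min_le_left _ _)))
  have hlamBs : lam ≤ 1 / (4 * Bs) := hlamle.trans ((min_le_right _ _).trans ((min_le_right _ _).trans (min_le_right _ _)))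
  obtain ⟨LW, hLW⟩ := hWs lam hlam hlamW'
  obtain ⟨LA, hLA⟩ := hA lam hlam hlamA'
  obtain ⟨LB, hLB⟩ := hB lam hlam hlamB'
  refine ⟨max (max LW (max LA LB)) ⌈8 * lam / s⌉₊, fun L _ hL β hW => ?_⟩
  have hLW' : LW ≤ L := ((le_max_left _ _).trans (le_max_left _ _)).trans hL
  have hLA' : LA ≤ L := (((le_max_left _ _).trans (le_max_right _ _)).trans (le_max_left _ _)).trans hL
  have hLB' : LB ≤ L := (((le_max_right _ _).trans (le_max_right _ _)).trans (le_max_left _ _)).trans hL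
  have hL8n : ⌈8 * lam / s⌉₊ ≤ L := (le_max_right _ _).trans hL
  have hL8 : 8 * lam / s ≤ (L : ℝ) := (Nat.le_ceil _).trans (by exact_mod_cast hL8n)
  -- the three eventual hypotheses at `(L, β)`
  have hweyl := hLW L hLW' β hW
  have hupJ := hLA L hLA' β hW
  have hupJ1 := hLB L hLB' β hW (J + 1) le_rfl
  have hBge : Bs ≤ oneSiteCoupling β L := oneSiteCoupling_ge_of_small hlam hW hBspos hlam8 hlamBs
  obtain ⟨hβ, hlamle', hlam2⟩ := hW
  -- scales
  set l : ℝ := luscherLambda β L with hldef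
  have hlpos : 0 < l := hlam.trans_le hlamle'
  have hLpos : (0 : ℝ) < L := Nat.cast_pos.mpr (NeZero.pos L)
  have hL1 : (1 : ℝ) ≤ L := by exact_mod_cast NeZero.one_le
  set x : ℝ := l / L with hxdef
  have hxpos : 0 < x := div_pos hlpos hLpos
  have hxl : x ≤ l := div_le_self hlpos.le hL1
  have hx1 : x ≤ 1 := by linarith only [hxl, hlam2, hlam8]
  have hx4 : x ≤ s / 4 := by
    rw [hxdef, div_le_iff₀ hLpos]
    have h1 : s / 4 * (8 * lam / s) ≤ s / 4 * (L : ℝ) := mul_le_mul_of_nonneg_left hL8 (by positivity)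
    have e : s / 4 * (8 * lam / s) = 2 * lam := by field_simp; ring
    linarith only [h1, e, hlam2]
  set B : ℝ := oneSiteCoupling β L with hBdef
  have hB0' : B0 ≤ B := (le_max_left _ _).trans hBge
  have hB1 : 1 ≤ B := hBs1.trans hBge
  have hbl : bareLambda B = x := by rw [hBdef, hxdef, hldef]; exact bareLambda_oneSiteCoupling hlpos
  have hmu0 : 0 < levelValue su2Rep 1 B 0 := levelValue_zero_su2Rep_pos 1 B
  have hl0 : 0 < levelValue su2Rep L β 0 := levelValue_zero_su2Rep_pos L β
  obtain ⟨-, hlowJ⟩ := hB0 B hB0'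
  -- times
  set T : ℕ := femtoSteps s β L with hTdef
  set T' : ℕ := femtoSteps (s / 2) β L with hT'def
  obtain ⟨hτlo0, hτhi0⟩ := femtoSteps_mul_bounds (s := s) (β := β) (L := L) hs.le hlpos
  obtain ⟨hτ'lo0, hτ'hi0⟩ := femtoSteps_mul_bounds (s := s / 2) (β := β) (L := L) (by positivity) hlpos
  have hτlo : s ≤ (T : ℝ) * x := hτlo0
  have hτhi : (T : ℝ) * x ≤ s + x := hτhi0
  have hτ'lo : s / 2 ≤ (T' : ℝ) * x := hτ'lo0
  have hτ'hi : (T' : ℝ) * x ≤ s / 2 + x := hτ'hi0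
  have hT'T : T' ≤ T := femtoSteps_mono (by linarith only [hs]) hlpos.le
  have hT'2r : (2 : ℝ) ≤ T' := by
    have h1 : 2 * x ≤ (T' : ℝ) * x := by linarith only [hx4, hτ'lo]
    exact le_of_mul_le_mul_right h1 hxpos
  have hT'2 : 2 ≤ T' := by exact_mod_cast hT'2r
  have hT2 : 2 ≤ T := hT'2.trans hT'T
  have hτ1 : (T : ℝ) * x ≤ s + 1 := by linarith only [hτhi, hx1]
  have hsub : (((T - T' : ℕ) : ℝ)) = (T : ℝ) - T' := Nat.cast_sub hT'T
  have hτdiff : s / 4 ≤ ((T - T' : ℕ) : ℝ) * x := by rw [hsub]; linarith only [hτlo, hτ'hi, hx4]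
  -- level currency
  set y : ℕ → ℝ := xval 1 B with hydef
  set z : ℕ → ℝ := xval L β with hzdef
  have hy0 : ∀ i, 0 ≤ y i := fun i => xval_nonneg hB1 i
  have hz0 : ∀ j, 0 ≤ z j := fun j => xval_nonneg hβ j
  have hz1 : ∀ j, z j ≤ 1 := fun j => xval_le_one hβ j
  have hzmono : ∀ {i j : ℕ}, i ≤ j → z j ≤ z i := fun hij => xval_le_xval hβ hij
  have hHS := hasSum_xval_pow (L := L) (β := β) hβ hT2
  have hHS' := hasSum_xval_pow (L := L) (β := β) hβ hT'2
  have hHS1 := hasSum_xval_pow (L := 1) (β := B) hB1 hT2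
  have hsumz : Summable (fun j => z j ^ T) := hHS.summable
  have hsumz' : Summable (fun j => z j ^ T') := hHS'.summable
  have hsumy : Summable (fun i => y i ^ T) := hHS1.summable
  have hl0T : 0 < levelValue su2Rep L β 0 ^ T := pow_pos hl0 T
  -- Weyl in level currency: `𝔷_L(T') ≤ C1`
  have hWeylz : ∑' j, z j ^ T' ≤ C1 := by
    have e : ∑' j, z j ^ T' = physTrace L β T' / levelValue su2Rep L β 0 ^ T' := hHS'.tsum_eq
    rw [e, div_le_iff₀ (pow_pos hl0 T')]
    exact hweyl.trans (mul_le_mul_of_nonneg_right hCW1 (pow_nonneg hl0.le _))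
  -- head: `z_j^T ≤ y_j^T + 2δ(s+1)` for `j ≤ J`
  have hhead_term : ∀ j : ℕ, j ≤ J → z j ^ T ≤ y j ^ T + 2 * δ * (s + 1) := by
    intro j hj
    have hup : levelValue su2Rep L β j ≤ Real.exp (-((levelGap j - δ) * l) / L) * levelValue su2Rep L β 0 := hupJ j hj
    have hlow : Real.exp (-((levelGap j + δ) * bareLambda B)) * levelValue su2Rep 1 B 0 ≤ levelValue su2Rep 1 B j := hlowJ j hj
    have hzj : z j ≤ Real.exp (-((levelGap j - δ) * x)) := by
      show levelValue su2Rep L β j / levelValue su2Rep L β 0 ≤ _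
      rw [div_le_iff₀ hl0]
      have e : -((levelGap j - δ) * l) / (L : ℝ) = -((levelGap j - δ) * x) := by rw [hxdef]; ring
      rw [← e]; exact hup
    have hyj : Real.exp (-((levelGap j + δ) * x)) ≤ y j := by
      show _ ≤ levelValue su2Rep 1 B j / levelValue su2Rep 1 B 0
      rw [le_div_iff₀ hmu0, ← hbl]; exact hlow
    -- `e^{-2δ T x} z_j^T ≤ y_j^T`
    have h1 : Real.exp (-(2 * δ * x)) * z j ≤ y j := by
      calc Real.exp (-(2 * δ * x)) * z j ≤ Real.exp (-(2 * δ * x)) * Real.exp (-((levelGap j - δ) * x)) :=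
            mul_le_mul_of_nonneg_left hzj (Real.exp_pos _).le
        _ = Real.exp (-((levelGap j + δ) * x)) := by rw [← Real.exp_add]; congr 1; ring
        _ ≤ y j := hyj
    have h2 : Real.exp (-(2 * δ * ((T : ℝ) * x))) * z j ^ T ≤ y j ^ T := by
      have := pow_le_pow_left₀ (mul_nonneg (Real.exp_pos _).le (hz0 j)) h1 T
      rw [mul_pow, ← Real.exp_nat_mul] at this
      have e : (T : ℝ) * -(2 * δ * x) = -(2 * δ * ((T : ℝ) * x)) := by ring
      rwa [e] at this
    have h3 : 1 - Real.exp (-(2 * δ * ((T : ℝ) * x))) ≤ 2 * δ * ((T : ℝ) * x) := by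
      linarith only [Real.add_one_le_exp (-(2 * δ * ((T : ℝ) * x)))]
    have h4 : (1 - Real.exp (-(2 * δ * ((T : ℝ) * x)))) * z j ^ T ≤ 2 * δ * (s + 1) := by
      have hzT1 : z j ^ T ≤ 1 := pow_le_one₀ (hz0 j) (hz1 j)
      have h5 : 2 * δ * ((T : ℝ) * x) ≤ 2 * δ * (s + 1) := mul_le_mul_of_nonneg_left hτ1 (by positivity)
      have h6 : 0 ≤ 1 - Real.exp (-(2 * δ * ((T : ℝ) * x))) := by
        have : Real.exp (-(2 * δ * ((T : ℝ) * x))) ≤ 1 := Real.exp_le_one_iff.mpr (by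
          have : 0 ≤ 2 * δ * ((T : ℝ) * x) := by positivity
          linarith only [this])
        linarith only [this]
      calc (1 - Real.exp (-(2 * δ * ((T : ℝ) * x)))) * z j ^ T ≤ (2 * δ * ((T : ℝ) * x)) * 1 :=
            mul_le_mul h3 hzT1 (pow_nonneg (hz0 j) T) (by positivity)
        _ ≤ 2 * δ * (s + 1) := by rw [mul_one]; exact h5
    nlinarith only [h2, h4]
  have hhead : ∑ j ∈ Finset.range (J + 1), z j ^ T ≤ ∑ j ∈ Finset.range (J + 1), y j ^ T + ε / 4 := by
    calc ∑ j ∈ Finset.range (J + 1), z j ^ T ≤ ∑ j ∈ Finset.range (J + 1), (y j ^ T + 2 * δ * (s + 1)) :=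
          Finset.sum_le_sum fun j hj => hhead_term j (Nat.lt_succ_iff.mp (Finset.mem_range.mp hj))
      _ = ∑ j ∈ Finset.range (J + 1), y j ^ T + ((J : ℝ) + 1) * (2 * δ * (s + 1)) := by
          rw [Finset.sum_add_distrib, Finset.sum_const, Finset.card_range, nsmul_eq_mul]; push_cast; ring
      _ = ∑ j ∈ Finset.range (J + 1), y j ^ T + ε / 4 := by rw [hδdef]; field_simp; ring
  -- tail: `Σ_{j ≥ J+1} z_j^T ≤ ε/4`
  have htail : ∑' j, z (j + (J + 1)) ^ T ≤ ε / 4 := by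
    have hsumN : Summable (fun j => z (j + (J + 1)) ^ T) := (summable_nat_add_iff (J + 1)).2 hsumz
    have hsumN' : Summable (fun j => z (j + (J + 1)) ^ T') := (summable_nat_add_iff (J + 1)).2 hsumz'
    have hshift : ∑' j, z (j + (J + 1)) ^ T' ≤ C1 := by
      have e := hsumz'.sum_add_tsum_nat_add (J + 1)
      have hh : 0 ≤ ∑ j ∈ Finset.range (J + 1), z j ^ T' := Finset.sum_nonneg fun j _ => pow_nonneg (hz0 j) T'
      linarith only [e, hh, hWeylz]
    have hzJ : z (J + 1) ≤ Real.exp (-((levelGap (J + 1) - 1) * x)) := by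
      show levelValue su2Rep L β (J + 1) / levelValue su2Rep L β 0 ≤ _
      rw [div_le_iff₀ hl0]
      have e : -((levelGap (J + 1) - 1) * l) / (L : ℝ) = -((levelGap (J + 1) - 1) * x) := by rw [hxdef]; ring
      rw [← e]; exact hupJ1
    have hpow : z (J + 1) ^ (T - T') ≤ ε / (4 * C1) := by
      have h1 : (levelGap (J + 1) - 1) * (s / 4) ≤ (levelGap (J + 1) - 1) * (((T - T' : ℕ) : ℝ) * x) :=
        mul_le_mul_of_nonneg_left hτdiff hrate
      have h2 : G ≤ (levelGap (J + 1) - 1) * (s / 4) := by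
        have e : 4 / s * G * (s / 4) = G := by field_simp
        have := mul_le_mul_of_nonneg_right hJ (show (0 : ℝ) ≤ s / 4 by positivity)
        linarith only [this, e]
      have hlogle : Real.log (4 * C1 / ε) ≤ G := le_max_right _ _
      calc z (J + 1) ^ (T - T') ≤ Real.exp (-((levelGap (J + 1) - 1) * x)) ^ (T - T') := pow_le_pow_left₀ (hz0 _) hzJ _
        _ = Real.exp (-((levelGap (J + 1) - 1) * (((T - T' : ℕ) : ℝ) * x))) := by rw [← Real.exp_nat_mul]; congr 1; ring
        _ ≤ Real.exp (-Real.log (4 * C1 / ε)) := Real.exp_le_exp.mpr (by linarith only [h1, h2, hlogle])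
        _ = ε / (4 * C1) := by rw [Real.exp_neg, Real.exp_log (by positivity)]; field_simp
    have hterm : ∀ j, z (j + (J + 1)) ^ T ≤ z (j + (J + 1)) ^ T' * z (J + 1) ^ (T - T') := by
      intro j
      have e : T' + (T - T') = T := Nat.add_sub_cancel' hT'T
      calc z (j + (J + 1)) ^ T = z (j + (J + 1)) ^ T' * z (j + (J + 1)) ^ (T - T') := by rw [← pow_add, e]
        _ ≤ z (j + (J + 1)) ^ T' * z (J + 1) ^ (T - T') :=
            mul_le_mul_of_nonneg_left (pow_le_pow_left₀ (hz0 _) (hzmono (by omega)) _) (pow_nonneg (hz0 _) _)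
    calc ∑' j, z (j + (J + 1)) ^ T ≤ ∑' j, z (j + (J + 1)) ^ T' * z (J + 1) ^ (T - T') := hsumN.tsum_le_tsum hterm (hsumN'.mul_right _)
      _ = (∑' j, z (j + (J + 1)) ^ T') * z (J + 1) ^ (T - T') := tsum_mul_right
      _ ≤ C1 * (ε / (4 * C1)) := mul_le_mul hshift hpow (pow_nonneg (hz0 _) _) hC1pos.le
      _ = ε / 4 := by field_simp
  -- total in level currency
  have hmain : ∑' j, z j ^ T ≤ ∑' i, y i ^ T + ε := by
    have e := (hsumz.sum_add_tsum_nat_add (J + 1)).symm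
    have hy_head : ∑ j ∈ Finset.range (J + 1), y j ^ T ≤ ∑' i, y i ^ T :=
      hsumy.sum_le_tsum (Finset.range (J + 1)) (fun j _ => pow_nonneg (hy0 j) T)
    rw [e]; linarith only [hhead, htail, hy_head, hε]
  -- back to traces
  have e1 : ∑' j, z j ^ T = physTrace L β T / levelValue su2Rep L β 0 ^ T := hHS.tsum_eq
  have e2 : ∑' i, y i ^ T = physTrace 1 B T / levelValue su2Rep 1 B 0 ^ T := hHS1.tsum_eq
  rw [e1, e2, div_le_iff₀ hl0T] at hmain
  exact hmain


/-! ## §2 `TwistedTraceScaling ⟹ UpperTraceLaw` — conditionally on `CoarseLevels` (workfile §4) and UNCONDITIONALLY via the landed INV (workfile §5) -/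

/-- (W1)+(W2) with the closed child `OneSiteTail` plugged in (workfile §4): `CoarseLevels → TwistedTraceScaling → UpperTraceLaw`. [cite: Luscher1983, §3] -/
theorem upperTraceLaw_of_twistedTraceScaling
    (hCL : ∀ k : ℕ, ∀ η : ℝ, 0 < η → ∃ lam0 : ℝ, 0 < lam0 ∧ ∀ lam : ℝ, 0 < lam → lam ≤ lam0 →
      ∃ L0 : ℕ, ∀ (L : ℕ) [NeZero L], L0 ≤ L → ∀ β : ℝ, InFemtoWindow lam β L →
        Real.exp (-((levelGap k + η) * luscherLambda β L) / L) * levelValue su2Rep L β 0 ≤ levelValue su2Rep L β k ∧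
          levelValue su2Rep L β k ≤ Real.exp (-((levelGap k - η) * luscherLambda β L) / L) * levelValue su2Rep L β 0)
    (hTTS : TwistedTraceScaling) : ∀ s : ℝ, 0 < s → ∀ ε : ℝ, 0 < ε → UTD.UpperTraceLawAt s ε :=
  upperTraceLaw_of_coarseLevels hCL (femtoWeyl_of_twistedTraceScaling hTTS OST.oneSiteTail_proof)

/-- ★ (workfile §5, GEN 8) **`TwistedTraceScaling ⟹ UpperTraceLaw` with NO side hypothesis**: the trace inversion INV is the landed tree theorem
`TraceDoor.coarseLevels_of_twistedTraceScaling` (children `TraceFormula` 20202 and `OneSiteTail` 20204 closed), so the one-sided law is a COROLLARY of the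
route child `TwistedTraceScaling` (stmt-QuantumFields-20203) as typed.  Credit ym-cruxidea-19978-1 (INV: ym-infvol-p1 g4). [cite: Luscher1983, §3] -/
theorem upperTraceLaw_of_twistedTraceScaling' (hTTS : TwistedTraceScaling) : ∀ s : ℝ, 0 < s → ∀ ε : ℝ, 0 < ε → UTD.UpperTraceLawAt s ε :=
  upperTraceLaw_of_twistedTraceScaling (TraceDoor.coarseLevels_of_twistedTraceScaling hTTS) hTTS

end Summit.QuantumFields.YangMills.Theorems.FemtoTransferGap.UTD

end
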